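import Literature.MathematicalPhysics.QuantumFieldTheory.Balaban1983to89.B9Eq3100LeibnizCommutatorCurl
import Literature.MathematicalPhysics.QuantumFieldTheory.Balaban1983to89.B9Eq3100LeibnizCommutatorDiv

/-!
# `Balaban1983to89.B9Eq3100LeibnizCommutatorEtaFree` — T. Bałaban, *Propagators for lattice gauge theories in a background field*, Commun. Math.
# Phys. **99** (1985) 389–434 [Balaban1985BackgroundPropagators] (3.100) p. 413 with p. 414 l. 1–3 «O(M⁻¹), or O(M⁻²), if considered on a proper
# scale»: **THE `η`-BOOKKEEPING OF THE LEIBNIZ COMMUTATOR LETTERS OF `D_U` (curl) AND `D*_U` (divergence) AT PRINT's SCALAR `c = η⁻¹`** — for cutoffs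
# Lipschitz on the UNIT scale (`|χ_j(b₋) − χ_j(b₊)| ≤ ℓη`, overlap `Σ_j(χ_j(b₋) − χ_j(b₊))² ≤ Nℓ²η²`): the single commutators and the first-order squares
# `a₁ = 8d·M_T²Nℓ²`, `a₂ = d·M_T²Nℓ²` carry NO `η`; the double-commutator letters `k₁ = 4√d·M_TNℓ²·η`, `k₂ = √d·M_TNℓ²·η` carry exactly ONE `η`; and THE
# PRODUCTS of kernel 7's cross terms `‖D_UA‖·‖(Σ_j ad_j ad_j D_U)A‖ ≤ 16d(1+M_T)M_T·Nℓ²·‖A‖²`, `‖D*_UA‖·‖(Σ_j ad_j ad_j D*_U)A‖ ≤ 2d(1+M_T)M_T·Nℓ²·‖A‖²`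
# carry NO `η`, NO volume, the background only through `M_T` — route R2′ STEP B8′ S-P7, instance-ledger row L7 of `t4/ROUTES-NE9.md` v13.30
# («the `η⁻¹` of L3∕L4 is CANCELLED INSIDE THE PRODUCT — kernel 7's design: no Young») for `T₁ = D_U`, `T₂ = D*_U`

statement-level skeleton of published theorems with citation tags; proofs where landed; nothing here is a claim about the Yang–Mills mass gap

CITATION HEADER (lean-in-tree rule).  Audit cell `pub-balaban`, sub-cell `t4`, BINDER row NE9; filed by NE9 formalisation-swarm LEAF PROVER 04
(`b2b-balaban-t4-ne9-formalise-leaf-04`, gen 76) on top of its `B9Eq3100LeibnizCommutatorCurl` ∕ `…Div` (same seat).  Source READ in the held text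
`paper:balaban1985-cmp99-background-propagators`: pp. 413–414 (3.100) and l. 1–3; p. 396 (3.35) (the scale on which the cutoffs vary).

THE PRINT (verbatim).  p. 414 l. 1–3: the commutators *«are first order differential operators with coefficients determined by derivatives of the
function h. They are of the order O(M⁻¹), or O(M⁻²), if considered on a proper scale.»*  The «proper scale» is the unit (physical) scale: the cutoffs
`h_□` of p. 408 vary over cubes of side `M` in units where the lattice spacing is `η`, so one lattice step changes `h` by `O(η∕M)` — the displayed
`ℓη` with `ℓ = ‖∇χ₀‖_∞∕M` (t4-ne9-idea-1's ledger letter `ℓ_χ`), and `N = 2^d` cubes overlap at a point.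

WHAT IS PROVED (sorry-free; proof lane — no `def`; [folklore] arithmetic on the two siblings' letters; nothing of [B9] asserted).
* §1 CURL (`B9Eq310HessianOperator.covCurlL2K 𝕜 c₀ η⁻¹ R`, transporters `‖R(b)v‖ ≤ M_T‖v‖`, maps `χS_j`, `χE_j` acting as the multiplications):
  **`norm_comm_covCurlL2K_le_etaFree`** (`‖χE(DA) − D(χS A)‖ ≤ 4√d·ℓM_T·‖A‖`), **`sum_norm_sq_comm_covCurlL2K_le_etaFree`** (`a₁`: `≤ 8d·M_T²·Nℓ²·‖A‖²`),
  `norm_sum_comm_comm_covCurlL2K_le_eta` (`k₁`: `≤ 4√d·M_T·Nℓ²·η·‖A‖`), **`norm_mul_norm_sum_comm_comm_covCurlL2K_le_etaFree`** (THE PRODUCT: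
  `≤ 16d·(1+M_T)M_T·Nℓ²·‖A‖²`).
* §2 DIVERGENCE (`B11Eq103H1Complex.covDivL2K 𝕜 c₀ η⁻¹ S`, `‖S(b)v‖ ≤ M_T‖v‖`, maps `χS_j`, `χ0_j`): **`norm_comm_covDivL2K_le_etaFree`** (`≤ √d·ℓM_T·‖A‖`),
  **`sum_norm_sq_comm_covDivL2K_le_etaFree`** (`a₂`: `≤ d·M_T²·Nℓ²·‖A‖²`), `norm_sum_comm_comm_covDivL2K_le_eta` (`k₂`: `≤ √d·M_T·Nℓ²·η·‖A‖`),
  **`norm_mul_norm_sum_comm_comm_covDivL2K_le_etaFree`** (THE PRODUCT: `≤ 2d·(1+M_T)M_T·Nℓ²·‖A‖²`).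
HONEST SCOPE.  Arithmetic (`‖η⁻¹‖·η = 1`) on the siblings' letters; the cutoffs and their two displayed facts are HYPOTHESES (no partition of unity is
constructed — FREEZE e34b3e0c (0)); `M_T` displayed (at the chain's `adTransportW φ U^{±1}` with `U(b) ∈ U1`: `M_T = M_φM_φ′`,
`B9Eq3101ConjugationLettersChain.norm_adTransportW_le`); NOT the assembly (kernel 7 ∕ `B9Eq387IMSAssembly`), NOT the non-local letter `W`, NOT the number
`M₀`; rows of ONE sub-step of a route step, NOT NE9 (cell pub-balaban: NE9 NOT PRINTED ∕ NOT PROVED; «NE9 ⇐ the named binders»; row WALLED ON A MODEL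
(O-NE9-1); spine PROVED 0∕9; rung (B)+1 on a finite T⁴ — NOT infinite volume, NOT mass gap, NOT Clay; HONEST DEPENDENCY: continuum YM on T⁴ ⇐ BetaPertH ∧
nine spine estimates (0/9 proved); BetaPertH ⇐ (D1) ∧ (D4) ∧ CAP+tail; G-an2-4 gates asym, D1 and NE2/3/4).  NEW file importing the two siblings only;
nothing modified.  Net new unproved facts: 0.
-/

noncomputable section

open scoped InnerProductSpace ComplexConjugate BigOperators
open Finset

namespace Literature.MathematicalPhysics.QuantumFieldTheory.Balaban1983to89.B9Eq3100LeibnizCommutatorEtaFree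

open B9SectCLatticeCarrier (Bond Plaq bpos btgt)
open B4Sect5Torus (TSite)
open B9Eq311L2Pairing (WL2)
open B11Eq103H1Complex (SiteL2K BondL2K covDivL2K)
open B9Eq310HessianOperator (PlaqL2K covCurlL2K)
open B9Eq3100LeibnizCommutatorCurl (norm_comm_covCurlL2K_le sum_norm_sq_comm_covCurlL2K_le norm_sum_comm_comm_covCurlL2K_le
  norm_covCurlL2K_le_of_transport)
open B9Eq3100LeibnizCommutatorDiv (norm_comm_covDivL2K_le sum_norm_sq_comm_covDivL2K_le norm_sum_comm_comm_covDivL2K_le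
  norm_covDivL2K_le_of_transport)

variable {𝕜 : Type*} [RCLike 𝕜] {d : ℕ} {Pd : Fin d → ℕ} {W : Type*} [NormedAddCommGroup W] [InnerProductSpace 𝕜 W]
  {c₀ : ℝ} [Fact (0 < c₀)] {MT η ℓ N : ℝ}

omit [Fact (0 < c₀)] in
/-- `‖(η : 𝕜)⁻¹‖ = η⁻¹` for `0 < η`. [folklore] -/
private theorem norm_inv_eta (hη : 0 < η) : ‖((η : 𝕜))⁻¹‖ = η⁻¹ := by
  rw [norm_inv, RCLike.norm_ofReal, abs_of_pos hη]

/-! ## §1 The curl `T₁ = D_U` -/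

section Curl

variable {R : Bond d Pd → W →ₗ[𝕜] W}

/-- **THE SINGLE COMMUTATOR IS `η`-FREE**: at `c = η⁻¹`, bond increments `|χ(b₋) − χ(b₊)| ≤ ℓη` (`0 ≤ ℓ`, `0 < η`):
`‖χE(DA) − D(χS A)‖ ≤ 4√d·ℓM_T·‖A‖` — NO `η`, NO volume, the background only through `M_T`. [folklore]
[cite: Balaban1985BackgroundPropagators, (3.100) p.413, p.414 «O(M⁻¹) … on a proper scale»] -/
theorem norm_comm_covCurlL2K_le_etaFree (hη : 0 < η) (hℓ : 0 ≤ ℓ) (hMT : 0 ≤ MT) (hR : ∀ b v, ‖R b v‖ ≤ MT * ‖v‖) {χ : TSite d Pd → ℝ}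
    (hχ : ∀ b : Bond d Pd, |χ (bpos b) - χ (btgt b)| ≤ ℓ * η)
    (χS : BondL2K 𝕜 d Pd c₀ W → BondL2K 𝕜 d Pd c₀ W) (χE : PlaqL2K 𝕜 d Pd c₀ W → PlaqL2K 𝕜 d Pd c₀ W)
    (hS : ∀ (A : BondL2K 𝕜 d Pd c₀ W) (b : Bond d Pd), WL2.equiv 𝕜 _ W (χS A) b = (χ (bpos b) : 𝕜) • WL2.equiv 𝕜 _ W A b)
    (hE : ∀ (G : PlaqL2K 𝕜 d Pd c₀ W) (p : Plaq d Pd), WL2.equiv 𝕜 _ W (χE G) p = (χ p.1 : 𝕜) • WL2.equiv 𝕜 _ W G p)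
    (A : BondL2K 𝕜 d Pd c₀ W) :
    ‖χE (covCurlL2K 𝕜 c₀ ((η : 𝕜))⁻¹ R A) - covCurlL2K 𝕜 c₀ ((η : 𝕜))⁻¹ R (χS A)‖ ≤ 4 * Real.sqrt d * (ℓ * MT) * ‖A‖ := by
  refine (norm_comm_covCurlL2K_le χS χE hMT hR (by positivity) hχ hS hE _ A).trans_eq ?_
  rw [norm_inv_eta hη]
  field_simp

/-- **THE FIRST-ORDER SQUARE `a₁` IS `η`-FREE**: at `c = η⁻¹` with the overlap bound `Σ_j(χ_j(b₋) − χ_j(b₊))² ≤ Nℓ²η²`: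
`Σ_j ‖χE_j(DA) − D(χS_j A)‖² ≤ 8d·M_T²·Nℓ²·‖A‖²`. [folklore] [cite: Balaban1985BackgroundPropagators, (3.100) p.413, p.408 «Σ h²_□ = 1»] -/
theorem sum_norm_sq_comm_covCurlL2K_le_etaFree (hη : 0 < η) (hN : 0 ≤ N) (hR : ∀ b v, ‖R b v‖ ≤ MT * ‖v‖) {J : Type*}
    (s : Finset J) {χf : J → TSite d Pd → ℝ} (hχ : ∀ b : Bond d Pd, ∑ j ∈ s, (χf j (bpos b) - χf j (btgt b)) ^ 2 ≤ N * ℓ ^ 2 * η ^ 2)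
    (χSf : J → BondL2K 𝕜 d Pd c₀ W → BondL2K 𝕜 d Pd c₀ W) (χEf : J → PlaqL2K 𝕜 d Pd c₀ W → PlaqL2K 𝕜 d Pd c₀ W)
    (hS : ∀ j (A : BondL2K 𝕜 d Pd c₀ W) (b : Bond d Pd), WL2.equiv 𝕜 _ W (χSf j A) b = (χf j (bpos b) : 𝕜) • WL2.equiv 𝕜 _ W A b)
    (hE : ∀ j (G : PlaqL2K 𝕜 d Pd c₀ W) (p : Plaq d Pd), WL2.equiv 𝕜 _ W (χEf j G) p = (χf j p.1 : 𝕜) • WL2.equiv 𝕜 _ W G p)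
    (A : BondL2K 𝕜 d Pd c₀ W) :
    ∑ j ∈ s, ‖χEf j (covCurlL2K 𝕜 c₀ ((η : 𝕜))⁻¹ R A) - covCurlL2K 𝕜 c₀ ((η : 𝕜))⁻¹ R (χSf j A)‖ ^ 2 ≤
      8 * d * MT ^ 2 * (N * ℓ ^ 2) * ‖A‖ ^ 2 := by
  refine (sum_norm_sq_comm_covCurlL2K_le hR s (by positivity) hχ χSf χEf hS hE _ A).trans_eq ?_
  rw [norm_inv_eta hη]
  field_simp

/-- **THE DOUBLE-COMMUTATOR LETTER `k₁` CARRIES EXACTLY ONE `η`**: at `c = η⁻¹` with `Σ_j(χ_j(b₋) − χ_j(b₊))² ≤ Nℓ²η²` (`0 ≤ N`):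
`‖(Σ_j ad_j(ad_j D))A‖ ≤ 4√d·M_T·Nℓ²·η·‖A‖`. [folklore] [cite: Balaban1985BackgroundPropagators, (3.100) p.413, p.414 «O(M⁻²)»] -/
theorem norm_sum_comm_comm_covCurlL2K_le_eta (hη : 0 < η) (hN : 0 ≤ N) (hMT : 0 ≤ MT) (hR : ∀ b v, ‖R b v‖ ≤ MT * ‖v‖) {J : Type*}
    (s : Finset J) {χf : J → TSite d Pd → ℝ} (hχ : ∀ b : Bond d Pd, ∑ j ∈ s, (χf j (bpos b) - χf j (btgt b)) ^ 2 ≤ N * ℓ ^ 2 * η ^ 2)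
    (χSf : J → BondL2K 𝕜 d Pd c₀ W → BondL2K 𝕜 d Pd c₀ W) (χEf : J → PlaqL2K 𝕜 d Pd c₀ W → PlaqL2K 𝕜 d Pd c₀ W)
    (hS : ∀ j (A : BondL2K 𝕜 d Pd c₀ W) (b : Bond d Pd), WL2.equiv 𝕜 _ W (χSf j A) b = (χf j (bpos b) : 𝕜) • WL2.equiv 𝕜 _ W A b)
    (hE : ∀ j (G : PlaqL2K 𝕜 d Pd c₀ W) (p : Plaq d Pd), WL2.equiv 𝕜 _ W (χEf j G) p = (χf j p.1 : 𝕜) • WL2.equiv 𝕜 _ W G p)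
    (A : BondL2K 𝕜 d Pd c₀ W) :
    ‖∑ j ∈ s, (χEf j (χEf j (covCurlL2K 𝕜 c₀ ((η : 𝕜))⁻¹ R A) - covCurlL2K 𝕜 c₀ ((η : 𝕜))⁻¹ R (χSf j A)) -
        (χEf j (covCurlL2K 𝕜 c₀ ((η : 𝕜))⁻¹ R (χSf j A)) - covCurlL2K 𝕜 c₀ ((η : 𝕜))⁻¹ R (χSf j (χSf j A))))‖ ≤
      4 * Real.sqrt d * (MT * (N * ℓ ^ 2) * η) * ‖A‖ := by
  refine (norm_sum_comm_comm_covCurlL2K_le hMT hR s (by positivity) hχ χSf χEf hS hE _ A).trans_eq ?_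
  rw [norm_inv_eta hη]
  field_simp

/-- **THE PRODUCT LETTER OF KERNEL 7's CROSS TERM IS `η`-FREE** (row L7: «the `η⁻¹` of L3 is CANCELLED INSIDE THE PRODUCT»): at `c = η⁻¹`,
transporters `‖R(b)v‖ ≤ M_T‖v‖`, a cutoff family with `Σ_j(χ_j(b₋) − χ_j(b₊))² ≤ Nℓ²η²`:
`‖D_UA‖·‖(Σ_j ad_j(ad_j D_U))A‖ ≤ 16d·(1+M_T)M_T·Nℓ²·‖A‖²` — NO `η`, NO volume, the background only through `M_T`. [folklore]
[cite: Balaban1985BackgroundPropagators, (3.100) p.413, p.414 «O(M⁻¹), or O(M⁻²), if considered on a proper scale», (3.88)–(3.89) p.409] -/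
theorem norm_mul_norm_sum_comm_comm_covCurlL2K_le_etaFree (hη : 0 < η) (hN : 0 ≤ N) (hMT : 0 ≤ MT) (hR : ∀ b v, ‖R b v‖ ≤ MT * ‖v‖)
    {J : Type*} (s : Finset J) {χf : J → TSite d Pd → ℝ}
    (hχ : ∀ b : Bond d Pd, ∑ j ∈ s, (χf j (bpos b) - χf j (btgt b)) ^ 2 ≤ N * ℓ ^ 2 * η ^ 2)
    (χSf : J → BondL2K 𝕜 d Pd c₀ W → BondL2K 𝕜 d Pd c₀ W) (χEf : J → PlaqL2K 𝕜 d Pd c₀ W → PlaqL2K 𝕜 d Pd c₀ W)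
    (hS : ∀ j (A : BondL2K 𝕜 d Pd c₀ W) (b : Bond d Pd), WL2.equiv 𝕜 _ W (χSf j A) b = (χf j (bpos b) : 𝕜) • WL2.equiv 𝕜 _ W A b)
    (hE : ∀ j (G : PlaqL2K 𝕜 d Pd c₀ W) (p : Plaq d Pd), WL2.equiv 𝕜 _ W (χEf j G) p = (χf j p.1 : 𝕜) • WL2.equiv 𝕜 _ W G p)
    (A : BondL2K 𝕜 d Pd c₀ W) :
    ‖covCurlL2K 𝕜 c₀ ((η : 𝕜))⁻¹ R A‖ *
        ‖∑ j ∈ s, (χEf j (χEf j (covCurlL2K 𝕜 c₀ ((η : 𝕜))⁻¹ R A) - covCurlL2K 𝕜 c₀ ((η : 𝕜))⁻¹ R (χSf j A)) -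
          (χEf j (covCurlL2K 𝕜 c₀ ((η : 𝕜))⁻¹ R (χSf j A)) - covCurlL2K 𝕜 c₀ ((η : 𝕜))⁻¹ R (χSf j (χSf j A))))‖ ≤
      16 * d * ((1 + MT) * MT * (N * ℓ ^ 2)) * ‖A‖ ^ 2 := by
  have ht := norm_covCurlL2K_le_of_transport hMT hR ((η : 𝕜))⁻¹ A
  have hk := norm_sum_comm_comm_covCurlL2K_le_eta hη hN hMT hR s hχ χSf χEf hS hE A
  rw [norm_inv_eta hη] at ht
  have ht0 : 0 ≤ 4 * Real.sqrt d * (η⁻¹ * (1 + MT)) * ‖A‖ := by positivity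
  have hk0 : 0 ≤ 4 * Real.sqrt d * (MT * (N * ℓ ^ 2) * η) * ‖A‖ := by positivity
  calc _ ≤ (4 * Real.sqrt d * (η⁻¹ * (1 + MT)) * ‖A‖) * (4 * Real.sqrt d * (MT * (N * ℓ ^ 2) * η) * ‖A‖) :=
        mul_le_mul ht hk (norm_nonneg _) ht0
    _ = 16 * (Real.sqrt d * Real.sqrt d) * (η⁻¹ * η) * ((1 + MT) * MT * (N * ℓ ^ 2)) * ‖A‖ ^ 2 := by ring
    _ = 16 * d * ((1 + MT) * MT * (N * ℓ ^ 2)) * ‖A‖ ^ 2 := by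
        rw [Real.mul_self_sqrt (Nat.cast_nonneg d), inv_mul_cancel₀ hη.ne', mul_one]

end Curl

/-! ## §2 The divergence `T₂ = D*_U` -/

section Div

variable {S : Bond d Pd → W →ₗ[𝕜] W}

/-- **THE SINGLE COMMUTATOR OF `D*` IS `η`-FREE**: at `c = η⁻¹`, bond increments `|χ(b₋) − χ(b₊)| ≤ ℓη` (`0 ≤ ℓ`, `0 < η`):
`‖χ0(D*A) − D*(χS A)‖ ≤ √d·ℓM_T·‖A‖`. [folklore] [cite: Balaban1985BackgroundPropagators, (3.100) p.413, p.414 «O(M⁻¹) … on a proper scale», (3.8) p.392] -/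
theorem norm_comm_covDivL2K_le_etaFree (hη : 0 < η) (hℓ : 0 ≤ ℓ) (hMT : 0 ≤ MT) (hR : ∀ b v, ‖S b v‖ ≤ MT * ‖v‖) {χ : TSite d Pd → ℝ}
    (hχ : ∀ b : Bond d Pd, |χ (bpos b) - χ (btgt b)| ≤ ℓ * η)
    (χS : BondL2K 𝕜 d Pd c₀ W → BondL2K 𝕜 d Pd c₀ W) (χ0 : SiteL2K 𝕜 d Pd c₀ W → SiteL2K 𝕜 d Pd c₀ W)
    (hS : ∀ (A : BondL2K 𝕜 d Pd c₀ W) (b : Bond d Pd), WL2.equiv 𝕜 _ W (χS A) b = (χ (bpos b) : 𝕜) • WL2.equiv 𝕜 _ W A b)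
    (h0 : ∀ (f : SiteL2K 𝕜 d Pd c₀ W) (y : TSite d Pd), WL2.equiv 𝕜 _ W (χ0 f) y = (χ y : 𝕜) • WL2.equiv 𝕜 _ W f y)
    (A : BondL2K 𝕜 d Pd c₀ W) :
    ‖χ0 (covDivL2K 𝕜 c₀ ((η : 𝕜))⁻¹ S A) - covDivL2K 𝕜 c₀ ((η : 𝕜))⁻¹ S (χS A)‖ ≤ Real.sqrt d * (ℓ * MT) * ‖A‖ := by
  refine (norm_comm_covDivL2K_le χS χ0 hMT hR (by positivity) hχ hS h0 _ A).trans_eq ?_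
  rw [norm_inv_eta hη]
  field_simp

/-- **THE FIRST-ORDER SQUARE `a₂` IS `η`-FREE**: at `c = η⁻¹` with `Σ_j(χ_j(b₋) − χ_j(b₊))² ≤ Nℓ²η²`: `Σ_j ‖χ0_j(D*A) − D*(χS_j A)‖² ≤ d·M_T²·Nℓ²·‖A‖²`.
[folklore] [cite: Balaban1985BackgroundPropagators, (3.100) p.413, p.408 «Σ h²_□ = 1», (3.8) p.392] -/
theorem sum_norm_sq_comm_covDivL2K_le_etaFree (hη : 0 < η) (hR : ∀ b v, ‖S b v‖ ≤ MT * ‖v‖) {J : Type*}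
    (s : Finset J) {χf : J → TSite d Pd → ℝ} (hχ : ∀ b : Bond d Pd, ∑ j ∈ s, (χf j (bpos b) - χf j (btgt b)) ^ 2 ≤ N * ℓ ^ 2 * η ^ 2)
    (χSf : J → BondL2K 𝕜 d Pd c₀ W → BondL2K 𝕜 d Pd c₀ W) (χ0f : J → SiteL2K 𝕜 d Pd c₀ W → SiteL2K 𝕜 d Pd c₀ W)
    (hS : ∀ j (A : BondL2K 𝕜 d Pd c₀ W) (b : Bond d Pd), WL2.equiv 𝕜 _ W (χSf j A) b = (χf j (bpos b) : 𝕜) • WL2.equiv 𝕜 _ W A b)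
    (h0 : ∀ j (f : SiteL2K 𝕜 d Pd c₀ W) (y : TSite d Pd), WL2.equiv 𝕜 _ W (χ0f j f) y = (χf j y : 𝕜) • WL2.equiv 𝕜 _ W f y)
    (A : BondL2K 𝕜 d Pd c₀ W) :
    ∑ j ∈ s, ‖χ0f j (covDivL2K 𝕜 c₀ ((η : 𝕜))⁻¹ S A) - covDivL2K 𝕜 c₀ ((η : 𝕜))⁻¹ S (χSf j A)‖ ^ 2 ≤ d * MT ^ 2 * (N * ℓ ^ 2) * ‖A‖ ^ 2 := by
  refine (sum_norm_sq_comm_covDivL2K_le hR s hχ χSf χ0f hS h0 _ A).trans_eq ?_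
  rw [norm_inv_eta hη]
  field_simp

/-- **THE DOUBLE-COMMUTATOR LETTER `k₂` CARRIES EXACTLY ONE `η`**: at `c = η⁻¹` with `Σ_j(χ_j(b₋) − χ_j(b₊))² ≤ Nℓ²η²` (`0 ≤ N`):
`‖(Σ_j ad_j(ad_j D*))A‖ ≤ √d·M_T·Nℓ²·η·‖A‖`. [folklore] [cite: Balaban1985BackgroundPropagators, (3.100) p.413, p.414 «O(M⁻²)», (3.8) p.392] -/
theorem norm_sum_comm_comm_covDivL2K_le_eta (hη : 0 < η) (hN : 0 ≤ N) (hMT : 0 ≤ MT) (hR : ∀ b v, ‖S b v‖ ≤ MT * ‖v‖) {J : Type*}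
    (s : Finset J) {χf : J → TSite d Pd → ℝ} (hχ : ∀ b : Bond d Pd, ∑ j ∈ s, (χf j (bpos b) - χf j (btgt b)) ^ 2 ≤ N * ℓ ^ 2 * η ^ 2)
    (χSf : J → BondL2K 𝕜 d Pd c₀ W → BondL2K 𝕜 d Pd c₀ W) (χ0f : J → SiteL2K 𝕜 d Pd c₀ W → SiteL2K 𝕜 d Pd c₀ W)
    (hS : ∀ j (A : BondL2K 𝕜 d Pd c₀ W) (b : Bond d Pd), WL2.equiv 𝕜 _ W (χSf j A) b = (χf j (bpos b) : 𝕜) • WL2.equiv 𝕜 _ W A b)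
    (h0 : ∀ j (f : SiteL2K 𝕜 d Pd c₀ W) (y : TSite d Pd), WL2.equiv 𝕜 _ W (χ0f j f) y = (χf j y : 𝕜) • WL2.equiv 𝕜 _ W f y)
    (A : BondL2K 𝕜 d Pd c₀ W) :
    ‖∑ j ∈ s, (χ0f j (χ0f j (covDivL2K 𝕜 c₀ ((η : 𝕜))⁻¹ S A) - covDivL2K 𝕜 c₀ ((η : 𝕜))⁻¹ S (χSf j A)) -
        (χ0f j (covDivL2K 𝕜 c₀ ((η : 𝕜))⁻¹ S (χSf j A)) - covDivL2K 𝕜 c₀ ((η : 𝕜))⁻¹ S (χSf j (χSf j A))))‖ ≤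
      Real.sqrt d * (MT * (N * ℓ ^ 2) * η) * ‖A‖ := by
  refine (norm_sum_comm_comm_covDivL2K_le hMT hR s (by positivity) hχ χSf χ0f hS h0 _ A).trans_eq ?_
  rw [norm_inv_eta hη]
  field_simp

/-- **THE PRODUCT LETTER OF KERNEL 7's CROSS TERM FOR `T₂ = D*` IS `η`-FREE** (row L7): at `c = η⁻¹`, transporters `‖S(b)v‖ ≤ M_T‖v‖`, a cutoff
family with `Σ_j(χ_j(b₋) − χ_j(b₊))² ≤ Nℓ²η²`: `‖D*A‖·‖(Σ_j ad_j(ad_j D*))A‖ ≤ 2d·(1+M_T)M_T·Nℓ²·‖A‖²` — NO `η`, NO volume. [folklore]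
[cite: Balaban1985BackgroundPropagators, (3.100) p.413, p.414 «O(M⁻¹), or O(M⁻²), if considered on a proper scale», (3.8) p.392] -/
theorem norm_mul_norm_sum_comm_comm_covDivL2K_le_etaFree (hη : 0 < η) (hN : 0 ≤ N) (hMT : 0 ≤ MT) (hR : ∀ b v, ‖S b v‖ ≤ MT * ‖v‖)
    {J : Type*} (s : Finset J) {χf : J → TSite d Pd → ℝ}
    (hχ : ∀ b : Bond d Pd, ∑ j ∈ s, (χf j (bpos b) - χf j (btgt b)) ^ 2 ≤ N * ℓ ^ 2 * η ^ 2)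
    (χSf : J → BondL2K 𝕜 d Pd c₀ W → BondL2K 𝕜 d Pd c₀ W) (χ0f : J → SiteL2K 𝕜 d Pd c₀ W → SiteL2K 𝕜 d Pd c₀ W)
    (hS : ∀ j (A : BondL2K 𝕜 d Pd c₀ W) (b : Bond d Pd), WL2.equiv 𝕜 _ W (χSf j A) b = (χf j (bpos b) : 𝕜) • WL2.equiv 𝕜 _ W A b)
    (h0 : ∀ j (f : SiteL2K 𝕜 d Pd c₀ W) (y : TSite d Pd), WL2.equiv 𝕜 _ W (χ0f j f) y = (χf j y : 𝕜) • WL2.equiv 𝕜 _ W f y)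
    (A : BondL2K 𝕜 d Pd c₀ W) :
    ‖covDivL2K 𝕜 c₀ ((η : 𝕜))⁻¹ S A‖ *
        ‖∑ j ∈ s, (χ0f j (χ0f j (covDivL2K 𝕜 c₀ ((η : 𝕜))⁻¹ S A) - covDivL2K 𝕜 c₀ ((η : 𝕜))⁻¹ S (χSf j A)) -
          (χ0f j (covDivL2K 𝕜 c₀ ((η : 𝕜))⁻¹ S (χSf j A)) - covDivL2K 𝕜 c₀ ((η : 𝕜))⁻¹ S (χSf j (χSf j A))))‖ ≤
      2 * d * ((1 + MT) * MT * (N * ℓ ^ 2)) * ‖A‖ ^ 2 := by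
  have ht := norm_covDivL2K_le_of_transport hMT hR ((η : 𝕜))⁻¹ A
  have hk := norm_sum_comm_comm_covDivL2K_le_eta hη hN hMT hR s hχ χSf χ0f hS h0 A
  rw [norm_inv_eta hη] at ht
  have ht0 : 0 ≤ 2 * Real.sqrt d * (η⁻¹ * (1 + MT)) * ‖A‖ := by positivity
  calc _ ≤ (2 * Real.sqrt d * (η⁻¹ * (1 + MT)) * ‖A‖) * (Real.sqrt d * (MT * (N * ℓ ^ 2) * η) * ‖A‖) :=
        mul_le_mul ht hk (norm_nonneg _) ht0
    _ = 2 * (Real.sqrt d * Real.sqrt d) * (η⁻¹ * η) * ((1 + MT) * MT * (N * ℓ ^ 2)) * ‖A‖ ^ 2 := by ring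
    _ = 2 * d * ((1 + MT) * MT * (N * ℓ ^ 2)) * ‖A‖ ^ 2 := by
        rw [Real.mul_self_sqrt (Nat.cast_nonneg d), inv_mul_cancel₀ hη.ne', mul_one]

end Div

end Literature.MathematicalPhysics.QuantumFieldTheory.Balaban1983to89.B9Eq3100LeibnizCommutatorEtaFree

end
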